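import Mathlib
import Summits.ValiantsHypothesis.ValiantsHypothesis.Theses.BarrierLever
import Literature.Computability.AlgebraicComplexity.ArithCircuitProofs
import Literature.Computability.AlgebraicComplexity.RazUniversalCircuits
import Summits.ValiantsHypothesis.ValiantsHypothesis.Theorems.BarrierLeverDefinableEquationsDefs
import Summits.ValiantsHypothesis.ValiantsHypothesis.Theorems.BarrierLeverDefinableEquationsStubRazTopUniversality
import Summits.ValiantsHypothesis.ValiantsHypothesis.Theorems.BarrierLeverDefinableEquationsQuasiPolyLemmas

/-!
# Crux `BarrierLever.DefinableEquations` (stmt-ValiantsHypothesis-8745) — the unconditional floor: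
# equations for `VP(n^b)` of polynomial degree and QUASI-polynomial size (lead c4)

`quasiPolyEquations` (registered sub-goal): for every size exponent `b` there are `k, n₀` such that
for all `n ≥ n₀` some NONZERO polynomial `E` in the `N = C(2n,n)` coefficient variables, of total
degree `≤ n^k = polylog(N)^{O(1)}` and fan-in-two size `≤ 2^(n^k) = quasipoly(N)`, vanishes at
`coeff(f)` for every `f ∈ SmallCircuits ℂ n b` (degree `≤ n`, size `≤ n^b`).  This is the folklore
dimension count (Heintz–Schnorr 1980; the starting point of Chatterjee–Tengse arXiv:2309.07612 §1.2)
made kernel-checked over the tree's objects: the crux asks for the same with size `N^a = 2^{O(an)}`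
and boolean sums, uniformly in `b`; unconditionally only this quasi-polynomial bound (or CT23's
VPSPACE-explicitness) is known, even for one fixed `b ≥ 2`.

Proof (lemmas in `…QuasiPolyLemmas.lean`).  Raz's polynomial map `Γ` (tree `RazUniversal.uCoeff`,
label-degree `≤ 2n - 1`, `RazUniversal.totalDegree_uCoeff_le`) parametrises the top components of
`SmallCircuits ℂ n b` (landed stub A `stub_razTopUniversality`) by
`m = #Lab ≤ 3 (2n + 4 n^b (n+1)² + 1)^5 ≤ n^(5b+21)` labels (`RazUniversal.card_lab_le`,
`QuasiPoly.labelBound_le_pow`).  Take `D = m + 1` blocks of `K = 2nD + 2` distinct top monomials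
(`QuasiPoly.exists_injective_topMonomials'`: `2^(n-1)` are available, `QuasiPoly.eventually_params`)
and the `K^D` square-free products of one variable per block: their pull-backs along `Γ` are `K^D`
polynomials of degree `≤ D (2n-1)` in `m` variables, a space of dimension `≤ (D(2n-1)+1)^m < K^D`,
so a nontrivial combination pulls back to `0` (`QuasiPoly.exists_annihilator`,
`LinearMap.ker_ne_bot_of_finrank_lt`); it is a nonzero polynomial (`QuasiPoly.blockPoly_ne_zero`),
vanishes at every Raz point hence at the top coefficients of every small circuit, and is
transported to `degLEMonomials n` along `topIncl`.  Sizes: `deg ≤ D ≤ n^k`,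
`L ≤ K^D (D + 2) ≤ 2^(n^k)`, `k = 5b + 24`.

No new definitions, no named facts.
-/

set_option linter.dupNamespace false

noncomputable section

namespace Summit.ValiantsHypothesis.ValiantsHypothesis.Theorems.BarrierLeverDefinableEquations

open MvPolynomial
open Literature.Computability.AlgebraicComplexity Literature.Barriers.ValiantsHypothesis
open scoped BigOperators

open QuasiPoly

/-! ## 5. The theorem -/

/-- **Registered sub-goal `quasiPolyEquations` — equations for `VP(n^b)` of polynomial degree and
quasi-polynomial size (the unconditional floor under the crux).**  For every `b` there are `k, n₀`
such that for all `n ≥ n₀` some nonzero `E` in the `N = C(2n,n)` coefficient variables with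
`deg E ≤ n^k` and `L(E) ≤ 2^(n^k)` vanishes at `coeff(f)` for every `f ∈ SmallCircuits ℂ n b`
(Heintz–Schnorr-type dimension count over Raz's degree-`(2n-1)` parametrisation of the top
components; `k = 5b + 24`).  The crux `DefinableEquations` asks for `L ≤ N^a = 2^{O(an)}` (as a
boolean sum) with `a` uniform in `b`. [folklore] -/
theorem quasiPolyEquations :
    ∀ b : ℕ, ∃ k n₀ : ℕ, ∀ n ≥ n₀, ∃ E : MvPolynomial ↥(Literature.Barriers.ValiantsHypothesis.degLEMonomials n) ℂ, E ≠ 0 ∧ E.totalDegree ≤ n ^ k ∧ Literature.Computability.AlgebraicComplexity.complexity E ≤ 2 ^ (n ^ k) ∧ ∀ f ∈ Literature.Barriers.ValiantsHypothesis.SmallCircuits ℂ n b, MvPolynomial.eval (Literature.Barriers.ValiantsHypothesis.coeffVector (Literature.Barriers.ValiantsHypothesis.degLEMonomials n) f) E = 0 := by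
  classical
  intro b
  obtain ⟨n₀, hn₀⟩ := eventually_params b
  refine ⟨5 * b + 24, n₀, fun n hn => ?_⟩
  obtain ⟨h3, havail, hK, hexp⟩ := hn₀ n hn
  -- Raz's labels and their count `m ≤ n^c₀`, `c₀ = 5b + 21`
  have hmle : Fintype.card (RazUniversal.Lab (Fin n) n (razSlots n b)) ≤ n ^ (5 * b + 21) := by
    have h1 := RazUniversal.card_lab_le (σ := Fin n) (r := n) (N := razSlots n b)
    rw [Fintype.card_fin] at h1
    refine h1.trans ?_
    unfold razSlots
    exact labelBound_le_pow b h3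
  set m := Fintype.card (RazUniversal.Lab (Fin n) n (razSlots n b)) with hm
  -- parameters: `D = m + 1` blocks of `K = 2nD + 2` top monomials
  set D := m + 1 with hD
  set K := 2 * n * D + 2 with hKdef
  have hDle : D ≤ n ^ (5 * b + 21) + 1 := by omega
  have hKle : K ≤ 2 * n * (n ^ (5 * b + 21) + 1) + 2 := by
    have := Nat.mul_le_mul_left (2 * n) hDle
    omega
  -- a supply of `D K` distinct top monomials
  obtain ⟨τ, hτ⟩ := exists_injective_topMonomials' (n := n) (by omega)
  have hDK : D * K ≤ Fintype.card (Fin (n - 1) → Bool) := by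
    rw [Fintype.card_fun, Fintype.card_bool, Fintype.card_fin]
    exact (Nat.mul_le_mul hDle hKle).trans havail
  let emb : Fin (D * K) ↪ (Fin (n - 1) → Bool) :=
    (Fin.castLEEmb hDK).trans (Fintype.equivFin (Fin (n - 1) → Bool)).symm.toEmbedding
  let t : Fin D × Fin K → topMonomials n := fun p => τ (emb (finProdFinEquiv p))
  have ht : Function.Injective t :=
    fun p q hpq => finProdFinEquiv.injective (emb.injective (hτ hpq))
  -- Raz's coordinates as polynomials in the labels, of degree `≤ 2n - 1`
  let u : topMonomials n → MvPolynomial (RazUniversal.Lab (Fin n) n (razSlots n b)) ℂ :=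
    fun e => RazUniversal.uCoeff ℂ (Fin n) n (razSlots n b) (e : Fin n →₀ ℕ)
  have hu : ∀ e, (u e).totalDegree ≤ 2 * n - 1 := fun e => RazUniversal.totalDegree_uCoeff_le _
  -- the dimension count `(D(2n-1)+1)^m < K^D`
  have hcard : (D * (2 * n - 1) + 1) ^ Fintype.card (RazUniversal.Lab (Fin n) n (razSlots n b)) <
      K ^ D := by
    rw [← hm]
    have h1 : D * (2 * n - 1) + 1 ≤ K - 1 := by
      have : D * (2 * n - 1) ≤ D * (2 * n) := Nat.mul_le_mul_left _ (Nat.sub_le _ _)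
      have : D * (2 * n) = 2 * n * D := by ring
      omega
    calc (D * (2 * n - 1) + 1) ^ m ≤ (K - 1) ^ m := Nat.pow_le_pow_left h1 m
      _ < K ^ m * K := by
          have hKm : (K - 1) ^ m ≤ K ^ m := Nat.pow_le_pow_left (Nat.sub_le _ _) m
          have hpos : 0 < K ^ m := pow_pos (by omega) m
          have h2 : 2 ≤ K := by omega
          nlinarith
      _ = K ^ D := by rw [hD, pow_succ]
  obtain ⟨c, hc0, hcomb⟩ := exists_annihilator u (2 * n - 1) hu D K t hcard
  -- the equation on the top coefficients, transported to all coefficients of degree `≤ n`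
  refine ⟨MvPolynomial.rename (topIncl n) (∑ g, c g • ∏ j, X (t (j, g j))), ?_, ?_, ?_, ?_⟩
  · -- nonzero
    intro hz
    exact blockPoly_ne_zero ht hc0
      (MvPolynomial.rename_injective _ (topIncl_injective n) (by rw [hz, map_zero]))
  · -- degree `≤ D ≤ n^(c₀+1) ≤ n^k`
    refine (MvPolynomial.totalDegree_rename_le _ _).trans ((totalDegree_blockPoly_le t c).trans ?_)
    have hp : 1 ≤ n ^ (5 * b + 21) := Nat.one_le_pow _ _ (by omega)
    calc D ≤ n ^ (5 * b + 21) + 1 := hDle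
      _ ≤ 2 * n ^ (5 * b + 21) := by omega
      _ ≤ n * n ^ (5 * b + 21) := Nat.mul_le_mul_right _ (by omega)
      _ = n ^ (5 * b + 21 + 1) := (pow_succ' _ _).symm
      _ ≤ n ^ (5 * b + 24) := Nat.pow_le_pow_right (by omega) (by omega)
  · -- size `≤ K^D (D+2) ≤ 2^(nD) 2^(D+1) ≤ 2^(n^k)`
    refine ((complexity_rename_le_holds' _ _).trans (complexity_blockPoly_le t c)).trans ?_
    have hK2 : K ≤ 2 ^ n := hKle.trans hK
    have h1 : K ^ D ≤ 2 ^ (n * D) := by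
      rw [pow_mul]
      exact Nat.pow_le_pow_left hK2 D
    have h2 : ∀ d : ℕ, d + 2 ≤ 2 ^ (d + 1) := by
      intro d
      induction d with
      | zero => norm_num
      | succ d ih => rw [pow_succ]; omega
    calc K ^ D * (D + 2) ≤ 2 ^ (n * D) * 2 ^ (D + 1) := Nat.mul_le_mul h1 (h2 D)
      _ = 2 ^ (n * D + (D + 1)) := by rw [← pow_add]
      _ ≤ 2 ^ (n ^ (5 * b + 24)) := by
          refine Nat.pow_le_pow_right (by norm_num) ?_
          have e1 : n * D + (D + 1) = (n + 1) * D + 1 := by ring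
          rw [e1]
          have := Nat.mul_le_mul_left (n + 1) hDle
          omega
  · -- vanishing on small circuits
    intro f hf
    rw [MvPolynomial.eval_rename]
    obtain ⟨y, hy⟩ := stub_razTopUniversality n b (by omega) f hf
    have hfun : (coeffVector (degLEMonomials n) f) ∘ (topIncl n) = razPoint n b y := by
      funext e
      rw [Function.comp_apply, coeffVector_apply, hy e]
      rfl
    rw [hfun, eval_blockPoly]
    have hcomb' := congrArg (MvPolynomial.eval y) hcomb
    rw [eval_blockComb, map_zero] at hcomb'
    have hrp : ∀ e, razPoint n b y e = MvPolynomial.eval y (u e) := fun e => rfl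
    simp_rw [hrp]
    exact hcomb'

end Summit.ValiantsHypothesis.ValiantsHypothesis.Theorems.BarrierLeverDefinableEquations

end
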